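import Literature.NumberTheory.Sieve.MoebiusExpSumDavenport

/-!
# Route `GreenTaoLevelTwo`, crux `MNTwo` (stmt-Parity-21276), line `birth`, stub `stub_mnVertical`:
# Möbius against trigonometric polynomials along a linear orbit on a torus (GT 2008b §6, first step)

First brick of block V1 of the `stub_mnVertical` census (B. Green, T. Tao, *Quadratic uniformity of
the Möbius function*, Ann. Inst. Fourier 58 (2008) = arXiv:math/0606087, §6, proof of (mu-1-step):
"By Lemma (lip-extend) and Lemma (fourier-approx) … it suffices to establish (mu-alpha)", i.e. a
`1`-step nilsequence is approximated by a trigonometric polynomial and each character is handled by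
Davenport's estimate).  This def-free file does the Davenport half: for a trigonometric polynomial
`P(y) = ∑_{h ∈ S} c_h e(h·y)` on `(ℝ/ℤ)^k` and a linear orbit `y_n = x + nα`,
`‖∑_{n ≤ N} μ(n) P(x + nα)‖ ≤ C_A (∑_h ‖c_h‖) N / log^A N`, uniformly in `k, S, c, α, x`
(`davenport` of the tree, character by character).

* `fourierChar_sum_linear` — `e(∑ᵢ hᵢ(xᵢ + nαᵢ)) = e(h·x) · e(n · (h·α))`;
* `norm_sum_moebius_trigPoly_le` — the estimate above.

References: [GreenTao2008QuadraticMobius] arXiv:math/0606087 §6 (mu-1-step); H. Davenport, Quart. J.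
Math. 8 (1937) 313–320 (tree: `MoebiusDavenport.davenport`).
-/

noncomputable section

open Finset Real ArithmeticFunction
open scoped FourierTransform ArithmeticFunction.Moebius

namespace Summit.Parity.GeneralizedHardyLittlewood.GreenTaoLevelTwoMNTwoMoebiusTrigPoly

open Literature.NumberTheory.Sieve.Vinogradov (afExpSum norm_fourierChar)
open Literature.NumberTheory.Sieve.MoebiusDavenport (davenport)

/-- `e(∑ᵢ hᵢ (xᵢ + n αᵢ)) = e(∑ᵢ hᵢ xᵢ) · e(n · ∑ᵢ hᵢ αᵢ)`. [folklore] -/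
theorem fourierChar_sum_linear {k : ℕ} (h : Fin k → ℤ) (x α : Fin k → ℝ) (n : ℕ) :
    (𝐞 (∑ i, (h i : ℝ) * (x i + n * α i)) : ℂ) =
      (𝐞 (∑ i, (h i : ℝ) * x i) : ℂ) * (𝐞 ((n : ℝ) * ∑ i, (h i : ℝ) * α i) : ℂ) := by
  have e : ∑ i, (h i : ℝ) * (x i + n * α i) = (∑ i, (h i : ℝ) * x i) + (n : ℝ) * ∑ i, (h i : ℝ) * α i := by
    rw [Finset.mul_sum, ← Finset.sum_add_distrib]
    exact Finset.sum_congr rfl fun i _ => by ring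
  rw [e, AddChar.map_add_eq_mul, Circle.coe_mul]

/-- **Möbius against a trigonometric polynomial along a linear orbit (GT 2008b §6, Davenport step).**
For every `A > 0` there is `C ≥ 0` such that for all `N ≥ 2`, all `k`, all finite sets `S` of
frequencies `h ∈ ℤ^k` with coefficients `c_h`, and all `α, x ∈ ℝ^k`:
`‖∑_{n ≤ N} μ(n) ∑_{h∈S} c_h e(h·(x + nα))‖ ≤ C (∑_{h∈S} ‖c_h‖) N / log^A N`.
[cite: GreenTao2008QuadraticMobius, §6, (mu-1-step)] -/
theorem norm_sum_moebius_trigPoly_le {A : ℝ} (hA : 0 < A) :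
    ∃ C : ℝ, 0 ≤ C ∧ ∀ N : ℕ, 2 ≤ N → ∀ (k : ℕ) (S : Finset (Fin k → ℤ)) (c : (Fin k → ℤ) → ℂ)
      (α x : Fin k → ℝ),
      ‖∑ n ∈ Icc 1 N, ((μ n : ℝ) : ℂ) *
          ∑ h ∈ S, c h * (𝐞 (∑ i, (h i : ℝ) * (x i + n * α i)) : ℂ)‖ ≤
        C * (∑ h ∈ S, ‖c h‖) * N / Real.log N ^ A := by
  obtain ⟨C, hC⟩ := davenport A hA
  refine ⟨max C 0, le_max_right _ _, fun N hN k S c α x => ?_⟩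
  have hlog : 0 < Real.log N := Real.log_pos (by exact_mod_cast (show 1 < N by omega))
  have hden : 0 < Real.log N ^ A := Real.rpow_pos_of_pos hlog A
  have hNpos : (0 : ℝ) < N := by exact_mod_cast (show 0 < N by omega)
  -- Davenport, character by character, with the nonnegative constant `max C 0`
  have hdav : ∀ β : ℝ, ‖afExpSum (fun n => (μ n : ℝ)) N β‖ ≤ max C 0 * N / Real.log N ^ A := by
    intro β
    refine (hC N hN β).trans ?_
    rw [div_le_div_iff_of_pos_right hden]
    exact mul_le_mul_of_nonneg_right (le_max_left _ _) hNpos.le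
  -- exchange the sums
  have hswap : ∑ n ∈ Icc 1 N, ((μ n : ℝ) : ℂ) *
      ∑ h ∈ S, c h * (𝐞 (∑ i, (h i : ℝ) * (x i + n * α i)) : ℂ) =
      ∑ h ∈ S, c h * (𝐞 (∑ i, (h i : ℝ) * x i) : ℂ) *
        afExpSum (fun n => (μ n : ℝ)) N (∑ i, (h i : ℝ) * α i) := by
    simp_rw [Finset.mul_sum]
    rw [Finset.sum_comm]
    refine Finset.sum_congr rfl fun h _ => ?_
    unfold afExpSum
    rw [Finset.mul_sum]
    refine Finset.sum_congr rfl fun n _ => ?_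
    rw [fourierChar_sum_linear]
    push_cast
    ring
  rw [hswap]
  calc ‖∑ h ∈ S, c h * (𝐞 (∑ i, (h i : ℝ) * x i) : ℂ) *
        afExpSum (fun n => (μ n : ℝ)) N (∑ i, (h i : ℝ) * α i)‖
      ≤ ∑ h ∈ S, ‖c h * (𝐞 (∑ i, (h i : ℝ) * x i) : ℂ) *
        afExpSum (fun n => (μ n : ℝ)) N (∑ i, (h i : ℝ) * α i)‖ := norm_sum_le _ _
    _ ≤ ∑ h ∈ S, ‖c h‖ * (max C 0 * N / Real.log N ^ A) := Finset.sum_le_sum fun h _ => by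
        rw [norm_mul, norm_mul, norm_fourierChar, mul_one]
        exact mul_le_mul_of_nonneg_left (hdav _) (norm_nonneg _)
    _ = max C 0 * (∑ h ∈ S, ‖c h‖) * N / Real.log N ^ A := by
        rw [← Finset.sum_mul]; ring

end Summit.Parity.GeneralizedHardyLittlewood.GreenTaoLevelTwoMNTwoMoebiusTrigPoly
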